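import Summits.Ventures.HodgeRepro2.T5RecordJointNine
import Summits.Ventures.HodgeRepro2.T5PrimeOverPlace

/-!
# Joint consistency at infinitely many places of `ℚ(ζ₉)`

Tier-5 support N3 / §G-N4.2 (seat p3, gen 88). The `ℚ(ζ₉)` companion of files 360 / 361 / 364: the primes `p ≡ 8 (mod 9)`
are infinite (file 280's `infinite_setOf_prime_and_eq_eight`) and have even order modulo `9` (`ord(8) = 2`), so the
record's `vEvenOf K 9` (the chosen place `placeAboveCyc K p` of `ℚ(ζ₉)⁺` above each prime `p ∤ 9` of even order modulo
`9`, injective) indexes infinitely many places; at each of them a prime `P` of `ℚ(ζ₉)` above the place is chosen with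
file 367's `primeOverPlace`, file 280's `exists_map_eq_iff_even_orderOf_nine` supplies `w` with `v 𝓞_K = w`, and
file 365's `discr_nine_notMem` reads file 356 there. Hence:

* `infinite_setOf_prime_and_coprime_nine_and_even_orderOf` — infinitely many primes `p ∤ 9` of even order modulo
  `9` (the class `8 (mod 9)`);
* `natCast_mem_vEvenOf_nine`, `exists_map_eq_vEvenOf_nine` — `p ∈ v_p` and `v_p` stays prime in `ℚ(ζ₉)`;
* **`infinite_setOf_joint_nine`** — the set of places `v` of `ℚ(ζ₉)⁺` above a prime `p ∤ 9` of even order modulo `9`,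
  staying prime (`v 𝓞_K = w`), at which the lattice-model data for `diag(1, 1, −1)` over `vRat p` AND the unramified
  spectrum of the record's pair (Satake parameter `α · N(v)⁻²`) hold, is INFINITE.

The set predicate is byte-for-byte the conclusion of file 365's `joint_nine_of_even_orderOf` (with `@vRat p hp` for the
`∃`-bound prime); the `LiesOver` instances are bound by explicit terms and passed explicitly (annex §101(b)).
§8(d): uses an L-value-free non-vanishing device: NO.
-/
open Matrix NumberField NumberField.IsCMField IsDedekindDomain IsDedekindDomain.HeightOneSpectrum Module
  MulAction
open scoped TensorProduct Pointwise
open Summit.Ventures.HodgeRepro2.T5UnitaryGroupForm Summit.Ventures.HodgeRepro2.T5UnitaryHeckeAdjoint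
  Summit.Ventures.HodgeRepro2.T5HeckePermutationModule Summit.Ventures.HodgeRepro2.LevelPositivity
  Summit.Ventures.HodgeRepro2.T5LevelIdempotent Summit.Ventures.HodgeRepro2.T5StarOfInvolution
  Summit.Ventures.HodgeRepro2.T5FinitePlaceCM Summit.Ventures.HodgeRepro2.T5NonSplitPlaceUnitaryGroup
  Summit.Ventures.HodgeRepro2.T5RecordHyperspecial Summit.Ventures.HodgeRepro2.T5GlobalLatticeAlmostAll
  Summit.Ventures.HodgeRepro2.T5HermitianThreeElements Summit.Ventures.HodgeRepro2.T5GaloisCartanThree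
  Summit.Ventures.HodgeRepro2.T5InertDegreeGalois Summit.Ventures.HodgeRepro2.T5InertPlaceCompletion
  Summit.Ventures.HodgeRepro2.T5InertDegreeAdicCompletion Summit.Ventures.HodgeRepro2.T5InertSatakeTransform
  Summit.Ventures.HodgeRepro2.T5InertSatakeTransformCompletion Summit.Ventures.HodgeRepro2.T5InertUnipotentResidue
  Summit.Ventures.HodgeRepro2.T5InertSphericalSubquotient Summit.Ventures.HodgeRepro2.T5RecordSatakeCell
  Summit.Ventures.HodgeRepro2.T5SplitPlaceUnitaryGroup Summit.Ventures.HodgeRepro2.T5FinitePlaceNormIndex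
  Summit.Ventures.HodgeRepro2.T5HermitianLocalIsotropyN3 Summit.Ventures.HodgeRepro2.T5FinitePlaceSplitClassification
  Summit.Ventures.HodgeRepro2.T5InertDegreeCompletion Summit.Ventures.HodgeRepro2.T5InertPlaceCompletionCells
  Summit.Ventures.HodgeRepro2.T5RecordSatake Summit.Ventures.HodgeRepro2.T5CartanCellsDistinct
  Summit.Ventures.HodgeRepro2.T5RecordSatakeInert Summit.Ventures.HodgeRepro2.T5InertGlobalPrime
  Summit.Ventures.HodgeRepro2.T5CMFieldSquareDatum Summit.Ventures.HodgeRepro2.T5RecordSatakeDegree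
  Summit.Ventures.HodgeRepro2.T5RecordSatakeDegreeIntrinsic Summit.Ventures.HodgeRepro2.T5RecordSphericalSpectrum
  Summit.Ventures.HodgeRepro2.T5RecordSphericalSpectrumIntrinsic Summit.Ventures.HodgeRepro2.T5RecordSatakeToy
  Summit.Ventures.HodgeRepro2.T5RecordSphericalSpectrumDatumFree
  Summit.Ventures.HodgeRepro2.T5AdditiveConductor Summit.Ventures.HodgeRepro2.T5UnitaryGroupIsometry
  Summit.Ventures.HodgeRepro2.T5ConductorDualLattice Summit.Ventures.HodgeRepro2.T5ConductorDualLatticeSplit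
  Summit.Ventures.HodgeRepro2.T5SplitHermitianClass Summit.Ventures.HodgeRepro2.T5RecordLatticeModelOutsideDiscriminant
  Summit.Ventures.HodgeRepro2.T5RecordLatticeModelSeven Summit.Ventures.HodgeRepro2.T5RecordJointOutsideDiscriminant
  Summit.Ventures.HodgeRepro2.T5RationalPlace Summit.Ventures.HodgeRepro2.T5DiscriminantUnramified
  Summit.Ventures.HodgeRepro2.T5CyclotomicSevenHeckeCommutative
  Summit.Ventures.HodgeRepro2.T5CyclotomicNineSextic Summit.Ventures.HodgeRepro2.T5CyclotomicSevenSplitPrime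
  Summit.Ventures.HodgeRepro2.T5RecordJointNine Summit.Ventures.HodgeRepro2.T5CyclotomicInfinitelyManyPlaces
  Summit.Ventures.HodgeRepro2.T5PrimeOverPlace

namespace Summit.Ventures.HodgeRepro2.T5RecordJointNineInfinitelyMany

universe uV

/-- **Infinitely many primes `p ∤ 9` of even order modulo `9`**: the class `8 (mod 9)` (file 280's Dirichlet
statement) has `ord(8 mod 9) = 2`. -/
theorem infinite_setOf_prime_and_coprime_nine_and_even_orderOf :
    {p : ℕ | p.Prime ∧ p.Coprime 9 ∧ Even (orderOf (p : ZMod 9))}.Infinite := by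
  refine infinite_setOf_prime_and_eq_eight.mono ?_
  rintro p ⟨hp, h8⟩
  have h8' : p % 9 = 8 := (ZMod.natCast_eq_natCast_iff' p 8 9).mp h8
  refine ⟨hp, ?_, ?_⟩
  · refine (Nat.Prime.coprime_iff_not_dvd hp).mpr fun h => ?_
    have h3 : p ∣ 3 := hp.dvd_of_dvd_pow (show p ∣ 3 ^ 2 by simpa using h)
    have := (Nat.prime_dvd_prime_iff_eq hp Nat.prime_three).mp h3
    omega
  · rw [h8, orderOf_eight_zmod_nine]
    decide

variable (K : Type*) [Field K] [CharZero K] [IsCyclotomicExtension {9} ℚ K]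
variable (k : Type*) [Field k] [CharZero k] [IsAlgClosed k]

/-- `p ∈ v_p` for the record's place `vEvenOf K 9 p`. -/
theorem natCast_mem_vEvenOf_nine (p : {p : ℕ // p.Prime ∧ p.Coprime 9 ∧ Even (orderOf (p : ZMod 9))}) :
    haveI := numberField_nine K
    (p.1 : 𝓞 (maximalRealSubfield K)) ∈ (vEvenOf K 9 p).asIdeal :=
  haveI := numberField_nine K
  haveI := liesOver_vEvenOf K 9 p
  natCast_mem_of_liesOver (maximalRealSubfield K) p.1 (vEvenOf K 9 p).asIdeal

/-- **`v_p` stays prime in `ℚ(ζ₉)`** (`ord(p mod 9)` even; file 280's criterion through the chosen prime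
`primeOverPlace K v_p` above `v_p`, file 367). -/
theorem exists_map_eq_vEvenOf_nine (p : {p : ℕ // p.Prime ∧ p.Coprime 9 ∧ Even (orderOf (p : ZMod 9))}) :
    haveI := numberField_nine K
    ∃ w : HeightOneSpectrum (𝓞 K),
      Ideal.map (algebraMap (𝓞 (maximalRealSubfield K)) (𝓞 K)) (vEvenOf K 9 p).asIdeal = w.asIdeal :=
  haveI := numberField_nine K
  haveI : Fact p.1.Prime := ⟨p.2.1⟩
  haveI := liesOver_vEvenOf K 9 p
  haveI := primeOverPlace_isPrime K (vEvenOf K 9 p)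
  haveI := primeOverPlace_liesOver K (vEvenOf K 9 p)
  haveI := primeOverPlace_liesOver_int K p.1 (vEvenOf K 9 p)
  (exists_map_eq_iff_even_orderOf_nine K p.1 ((Nat.Prime.coprime_iff_not_dvd p.2.1).mp p.2.2.1)
    (primeOverPlace K (vEvenOf K 9 p)).1 (vEvenOf K 9 p)).mpr p.2.2.2

/-- **AT INFINITELY MANY PLACES OF `ℚ(ζ₉)⁺` THE JOINT STATEMENT HOLDS**: the set of places `v` above a prime `p ∤ 9`
of even order modulo `9`, staying prime (`v 𝓞_K = w`), at which the lattice-model data for `diag(1, 1, −1)` over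
`vRat p` AND the unramified spectrum of the record's pair (Satake parameter `α · N(v)⁻²`) hold, is infinite. -/
theorem infinite_setOf_joint_nine :
    haveI := numberField_nine K
    haveI := isCMField_nine K
    {v : HeightOneSpectrum (𝓞 (maximalRealSubfield K)) |
      ∃ (p : ℕ) (hp : Fact p.Prime) (_hp9 : ¬ p ∣ 9) (_hEven : Even (orderOf (p : ZMod 9)))
        (hmem : (p : 𝓞 (maximalRealSubfield K)) ∈ v.asIdeal),
        letI : v.asIdeal.LiesOver (@vRat p hp).asIdeal := @liesOver_vRat_of_mem p hp _ _ _ v hmem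
        ∃ (w : HeightOneSpectrum (𝓞 K))
          (hmap : Ideal.map (algebraMap (𝓞 (maximalRealSubfield K)) (𝓞 K)) v.asIdeal = w.asIdeal),
          letI := liesOver_of_map_eq K v w hmap
          ((∃ ψ : AddChar ((@vRat p hp).adicCompletion ℚ) Circle, Continuous ψ ∧ (∃ y, ψ y ≠ 1) ∧
            conductorExp ψ (Valued.v : Valuation ((@vRat p hp).adicCompletion ℚ) (WithZero (Multiplicative ℤ))) = 0 ∧
            conductorExp (ψ.compAddMonoidHom
              (Algebra.trace ((@vRat p hp).adicCompletion ℚ) (v.adicCompletion (maximalRealSubfield K))).toAddMonoidHom)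
              (Valued.v : Valuation (v.adicCompletion (maximalRealSubfield K)) (WithZero (Multiplicative ℤ))) = 0) ∧
          ∀ (ψ : AddChar ((@vRat p hp).adicCompletion ℚ) Circle), Continuous ψ → (∃ y, ψ y ≠ 1) →
            conductorExp ψ (Valued.v : Valuation ((@vRat p hp).adicCompletion ℚ) (WithZero (Multiplicative ℤ))) = 0 →
            ∀ (w' : HeightOneSpectrum (𝓞 K)) [w'.asIdeal.LiesOver v.asIdeal],
              v.asIdeal.ramificationIdx' w'.asIdeal = 1 ∧
              conductorExp (recordChar K (@vRat p hp) v w' ψ)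
                (Valued.v : Valuation (w'.adicCompletion K) (WithZero (Multiplicative ℤ))) = 0 ∧
              (∀ x : w'.adicCompletion K,
                (∀ y : w'.adicCompletion K, Valued.v y ≤ 1 → recordChar K (@vRat p hp) v w' ψ (x * y) = 1) ↔ Valued.v x ≤ 1) ∧
              (∀ [StarRing (w'.adicCompletion K)],
                (∀ z : w'.adicCompletion K, IsLocalization.IsInteger (w'.adicCompletionIntegers K) z →
                  IsLocalization.IsInteger (w'.adicCompletionIntegers K) (star z)) →
                ∀ x : Fin 3 → w'.adicCompletion K,
                  (∀ y ∈ stdLattice (w'.adicCompletionIntegers K),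
                    recordChar K (@vRat p hp) v w' ψ
                      (sesqForm (((algebraMap (𝓞 K) K).mapMatrix (Matrix.diagonal ![1, 1, -1])).map (algebraMap K (w'.adicCompletion K))) x y) = 1) ↔
                    x ∈ stdLattice (w'.adicCompletionIntegers K)) ∧
              (letI := swapStarRing (w'.adicCompletion K)
                ∀ x : Fin 3 → w'.adicCompletion K × w'.adicCompletion K,
                  (∀ y : Fin 3 → w'.adicCompletion K × w'.adicCompletion K,
                    (∀ i, Valued.v (y i).1 ≤ 1 ∧ Valued.v (y i).2 ≤ 1) →
                    recordChar K (@vRat p hp) v w' ψ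
                        (sesqForm (pairMatrix (((algebraMap (𝓞 K) K).mapMatrix (Matrix.diagonal ![1, 1, -1])).map (algebraMap K (w'.adicCompletion K)))
                          (((algebraMap (𝓞 K) K).mapMatrix (Matrix.diagonal ![1, 1, -1])).map (algebraMap K (w'.adicCompletion K)))ᵀ) x y).1 *
                      recordChar K (@vRat p hp) v w' ψ
                        (sesqForm (pairMatrix (((algebraMap (𝓞 K) K).mapMatrix (Matrix.diagonal ![1, 1, -1])).map (algebraMap K (w'.adicCompletion K)))
                          (((algebraMap (𝓞 K) K).mapMatrix (Matrix.diagonal ![1, 1, -1])).map (algebraMap K (w'.adicCompletion K)))ᵀ) x y).2 = 1) ↔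
                    ∀ i, Valued.v (x i).1 ≤ 1 ∧ Valued.v (x i).2 ≤ 1)) ∧
          (∃ (θ : maximalRealSubfield K) (y : K) (hθ : algebraMap (maximalRealSubfield K) K θ = y ^ 2)
            (hy : complexConj K y ≠ y) (r : ℕ) (l : Fin r → 𝓞 K)
            (_hl : Submodule.span (𝓞 (maximalRealSubfield K)) (Set.range l) = ⊤),
            letI := tensorStarRing K v
            letI := starRingOfQuadratic (finrank_eq_two K v w hθ hy (not_isSquare_of_staysPrime K v w hθ hy hmap))
              (localConj v w hθ.symm (span_pair_eq_top K hy) (not_isSquare_of_staysPrime K v w hθ hy hmap) (complexConj K))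
              (localConj_ne_one v w hθ.symm (span_pair_eq_top K hy) (not_isSquare_of_staysPrime K v w hθ hy hmap)
                (complexConj K) (complexConj_apply_eq_neg K hθ hy))
            haveI := isDiscreteValuationRing_integralClosure_adicCompletion v w
            haveI := finite_residueField_integralClosure_adicCompletion v w
            haveI : IsFractionRing (integralClosure (v.adicCompletionIntegers (maximalRealSubfield K)) (w.adicCompletion K))
              (w.adicCompletion K) :=
              integralClosure.isFractionRing_of_finite_extension (v.adicCompletion (maximalRealSubfield K))
                (w.adicCompletion K)
            ∃ (u₀ : (v.adicCompletionIntegers (maximalRealSubfield K))ˣ)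
              (Φ : ↥(formUnitaryGroup (J3 (algebraMap (v.adicCompletionIntegers (maximalRealSubfield K))
                (w.adicCompletion K) (u₀ : v.adicCompletionIntegers (maximalRealSubfield K))))) ≃*
                ↥(formUnitaryGroup (tensorGram K v (gramToy K))))
              (ϖ' : integralClosure (v.adicCompletionIntegers (maximalRealSubfield K)) (w.adicCompletion K))
              (hϖ' : Irreducible ϖ')
              (hs' : star (algebraMap (integralClosure (v.adicCompletionIntegers (maximalRealSubfield K))
                (w.adicCompletion K)) (w.adicCompletion K) ϖ') =
                  algebraMap (integralClosure (v.adicCompletionIntegers (maximalRealSubfield K)) (w.adicCompletion K))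
                    (w.adicCompletion K) ϖ'),
              (∀ g, g ∈ hyperspecialSubgroup
                  (integralClosure (v.adicCompletionIntegers (maximalRealSubfield K)) (w.adicCompletion K))
                  (J3 (algebraMap (v.adicCompletionIntegers (maximalRealSubfield K)) (w.adicCompletion K)
                    (u₀ : v.adicCompletionIntegers (maximalRealSubfield K)))) ↔ Φ g ∈ recordHyperspecial K v l (gramToy K)) ∧
              ∀ {V : Type uV} [AddCommGroup V] [Module k V]
                (ρ : Representation k (↥(formUnitaryGroup (tensorGram K v (gramToy K)))) V) [ρ.IsIrreducible],
                KFinite ρ (recordHyperspecial K v l (gramToy K)) →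
                ∀ [FiniteDimensional k (invariants ρ (recordHyperspecial K v l (gramToy K)))],
                invariants ρ (recordHyperspecial K v l (gramToy K)) ≠ ⊥ →
                ∃ α : k, α ≠ 0 ∧ Nonempty (ρ.Equiv (comp Φ.symm
                  (inertSphericalQuot
                    (hstar_of_star_eq (localConj v w hθ.symm (span_pair_eq_top K hy)
                      (not_isSquare_of_staysPrime K v w hθ hy hmap) (complexConj K))
                      (fun x => by rw [star_p8_eq_star K v w hθ hy (not_isSquare_of_staysPrime K v w hθ hy hmap)]; rfl))
                    (algebraMap (v.adicCompletionIntegers (maximalRealSubfield K)) (w.adicCompletion K)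
                      (u₀ : v.adicCompletionIntegers (maximalRealSubfield K)))
                    (star_algebraMap_of_star_eq (localConj v w hθ.symm (span_pair_eq_top K hy)
                      (not_isSquare_of_staysPrime K v w hθ hy hmap) (complexConj K))
                      (fun x => by rw [star_p8_eq_star K v w hθ hy (not_isSquare_of_staysPrime K v w hθ hy hmap)]; rfl)
                      (u₀ : v.adicCompletionIntegers (maximalRealSubfield K)))
                    (algebraMap_unit_ne_zero (F := v.adicCompletion (maximalRealSubfield K)) u₀)
                    (isInteger_algebraMap (u₀ : v.adicCompletionIntegers (maximalRealSubfield K)))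
                    (isInteger_algebraMap_unit_inv u₀) hϖ' hs' k (α * ((Ideal.absNorm v.asIdeal : k) ^ 2)⁻¹)))))}.Infinite :=
  haveI := numberField_nine K
  haveI := isCMField_nine K
  haveI : Infinite {p : ℕ // p.Prime ∧ p.Coprime 9 ∧ Even (orderOf (p : ZMod 9))} :=
    infinite_setOf_prime_and_coprime_nine_and_even_orderOf.to_subtype
  Set.infinite_of_injective_forall_mem (vEvenOf_injective K 9) fun p =>
    haveI hp : Fact p.1.Prime := ⟨p.2.1⟩
    (exists_map_eq_vEvenOf_nine K p).elim fun w hmap =>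
      ⟨p.1, hp, (Nat.Prime.coprime_iff_not_dvd p.2.1).mp p.2.2.1, p.2.2.2, natCast_mem_vEvenOf_nine K p, w, hmap,
        @joint_outside_discriminant_of_staysPrime K _ (numberField_nine K) (isCMField_nine K) (@vRat p.1 hp) (vEvenOf K 9 p)
          (@liesOver_vRat_of_mem p.1 hp _ _ _ (vEvenOf K 9 p) (natCast_mem_vEvenOf_nine K p))
          (discr_nine_notMem K p.1 ((Nat.Prime.coprime_iff_not_dvd p.2.1).mp p.2.2.1) (vEvenOf K 9 p) (natCast_mem_vEvenOf_nine K p))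
          w (liesOver_of_map_eq K (vEvenOf K 9 p) w hmap) hmap k _ _ _⟩

end Summit.Ventures.HodgeRepro2.T5RecordJointNineInfinitelyMany
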